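import Summits.HubbardSuperconductivity.HubbardSuperconductivity.Theorems.AnisotropyChordTransferFibre3RowDCellCheckW
import Summits.HubbardSuperconductivity.HubbardSuperconductivity.Theorems.AnisotropyChordTransferFibre3RowDCheckS

/-!
# Route `AnisotropyChord` / H0 rotor rung, row D (KT-2a): the FIRST-ORDER class check for the GENERIC-zone-constant program
(`termEC czE`, p1 g31 `…RowDCellCheckW`) and its `c_W` specialisation — ★★★ orbit-form soundness

p1 g31 ASK to p2 (STATUS 2026-08-30T19:16Z): «a FIRST-ORDER (Krawczyk–Neumaier) class check for row D — input `RowD.termEW τlo τhi k₂ k₃`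
over `RowD.rowDBox c a1 a2 pi`; output per class a real row bound `T(k) ≤ V²θ²·b_k`».  `…RowDCheckS` (p2 g7) did this for the Stage-1
program `termE`; THIS FILE does it for p1's generic program `termEC czE` (any zone-constant atom) and for `termEW = termEC cWE` (Stage 1.5):
* ★ `classCheckCS czE c a₁ a₂ τlo τhi pi kk b` — `L2.sdEnclose` on the centred stage-1 environment `envC` of the row-D box (moving
  coordinates `ν` (2), `a` (3); the sinc/still coordinates stay zero-order automatically), centred upper bound `≤ b`; ★ `classCheckCS_sound`;
* ★★★ `lowG_of_orbitChecksCS` — p1's `lowG_of_orbitChecksC` with TWO representative tables: `repsZ` (zero-order `classCheckC` rows) `++`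
  `repsS` (first-order `classCheckCS` rows), the orbit table indexing the concatenation;
* ★ `classCheckWS := classCheckCS cWE`, ★★★ `lowG_of_orbitChecksWS` (no extra hypothesis: `wg_hypW`, `eval_cWE`) — the `hKT2a` input of
  `gm3_of_cell` / `L2.cell_closed` on the cell for every `L ≥ 128`.
Measured gain of first order over zero order on the same program (Stage 1, `…RowDCheckS` docstring): a_D .117 → .062 (05370×[0,.15]),
.150 → .105 (20077×[0,.1]); kernel cost per class unchanged (≈ 20–30 s).
Prover seat `hubbard-h0-rotor-p2` g7; helper for piece A = stmt-HubbardSuperconductivity-23918 of rung 19089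
(`--supports`, helper class).  Nothing here proves superconductivity in the Hubbard model; ONE row of ONE conditional reduction, cell by cell;
the rotor TARGET as originally worded stays FALSE (g15 verdict).  Tree imports only; no sorry.
-/

set_option linter.dupNamespace false
set_option autoImplicit false

open scoped BigOperators
open Literature.Analysis.ValidatedNumerics

namespace Summit.HubbardSuperconductivity.HubbardSuperconductivity.Theorems.AnisotropyChord.Transfer.Fibre3

namespace RowD

open RowC L2 L2.N1

variable (L : ℕ) [NeZero L]

/-! ## The first-order class check, generic zone-constant atom (computable) -/

/-- ★ FIRST-ORDER CHECK of ONE class of the generic program `termEC czE` against a rational budget `b`. -/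
def classCheckCS (czE : RExpr) (c : L2.NamedCell) (a1 a2 τlo τhi : ℚ) (pi : ℕ × ℕ) (kk : (ℤ × ℤ) × (ℤ × ℤ)) (b : ℚ) : Bool :=
  match rowDBox c a1 a2 pi with
  | none => false
  | some B =>
    match sdEnclose pi.1 pi.2 (envC B) (termEC czE τlo τhi kk.1 kk.2) with
    | none => false
    | some M => decide (M.ub (incrI (B.toIvl 2) (midI (B.toIvl 2))) (incrI (B.toIvl 3) (midI (B.toIvl 3))) ≤ b)

/-- ★ the `c_W` first-order class check. -/
def classCheckWS (c : L2.NamedCell) (a1 a2 τlo τhi : ℚ) (pi : ℕ × ℕ) (kk : (ℤ × ℤ) × (ℤ × ℤ)) (b : ℚ) : Bool :=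
  classCheckCS cWE c a1 a2 τlo τhi pi kk b

omit [NeZero L] in
/-- ★ soundness of the generic first-order class check: `(termEC czE).eval x ≤ b` at every point of the row-D box. -/
theorem classCheckCS_sound {czE : RExpr} {c : L2.NamedCell} {a1 a2 τlo τhi : ℚ} {pi : ℕ × ℕ} {kk : (ℤ × ℤ) × (ℤ × ℤ)} {b : ℚ}
    (h : classCheckCS czE c a1 a2 τlo τhi pi kk b = true) {B : Box} (hB : rowDBox c a1 a2 pi = some B)
    {x : ℕ → ℝ} (hx : B.mem x) :
    (termEC czE τlo τhi kk.1 kk.2).eval x ≤ ((b : ℚ) : ℝ) := by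
  unfold classCheckCS at h
  rw [hB] at h
  simp only at h
  split at h
  · exact absurd h (by simp)
  · rename_i M hM
    have hb : M.ub (incrI (B.toIvl 2) (midI (B.toIvl 2))) (incrI (B.toIvl 3) (midI (B.toIvl 3))) ≤ b := of_decide_eq_true h
    have hbd := sdEnclose_bounds (holds_envC hx) (incr_mem hx 2) (incr_mem hx 3) _ hM
    exact hbd.2.trans (by exact_mod_cast hb)

/-! ## The orbit form -/

section sound
variable (Δ lam2 : ℝ) (f : Tor L → ℝ)

/-- ★★★ **ORBIT FORM, generic zone constant, FIRST-ORDER rows**: `repsZ` certified by `classCheckC czE` (zero order), `repsS` by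
`classCheckCS czE` (first order), the orbit table indexing `repsZ ++ repsS`; with the zone hypotheses of `lowG_of_orbitChecksC`
(`0 ≤ cz`, `(w g)² ≤ cz·g`, `czE ↦ cz`), the budget sum, the `ê₁` and `τ` checks: `lowGForm ≤ a_D·η_eff·U` on the cell for every `L ≥ 128`. -/
theorem lowG_of_orbitChecksCS (czE : RExpr) (c : L2.NamedCell) {cz : ℝ} (hcz0 : 0 ≤ cz)
    (hwg : ∀ q : Tor L, ∀ e ∈ E4, (wnorm L q (B1.toTor L e) * gres L lam2 q) ^ 2 ≤ cz * gres L lam2 q)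
    (hcz : czE.eval (xTrueD L Δ lam2 f) = cz)
    (a1 a2 aD τlo τhi : ℚ) (pi piT : ℕ × ℕ)
    (repsZ repsS : List (((ℤ × ℤ) × (ℤ × ℤ)) × ℚ)) (orb : List (((ℤ × ℤ) × (ℤ × ℤ)) × (ℕ × List ℕ)))
    (hrepsMem : ((repsZ ++ repsS).all fun p => decide (p.1 ∈ lowList)) = true)
    (hrepsZ : (repsZ.all fun p => classCheckC czE c a1 a2 τlo τhi pi p.1 p.2) = true)
    (hrepsS : (repsS.all fun p => classCheckCS czE c a1 a2 τlo τhi pi p.1 p.2) = true)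
    (horb : orb.map Prod.fst = lowList) (hok : (orb.all (orbitRowOk (repsZ ++ repsS))) = true)
    (hsum : (orb.map (orbitBudget (repsZ ++ repsS))).sum ≤ 3 * (98696 / 10000) * aD * ((c.n1 : ℚ) / c.νd) * τlo)
    (haD : 0 ≤ aD) (hτlo0 : 0 ≤ τlo) (he1 : e1Check c a1 a2 τhi pi = true) (hτ : tauCheck c a1 a2 τlo τhi piT = true)
    (hc : c.check = true) (hL : 128 ≤ L)
    (hΔ0 : 0 ≤ Δ) (hΔ1 : Δ < 1) (hf : IsGroundTwoMagnon L Δ lam2 f)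
    (hν1 : (c.n1 : ℝ) / c.νd ≤ lam2 / (2 * Real.pi / L) ^ 2) (hν2 : lam2 / (2 * Real.pi / L) ^ 2 ≤ (c.n2 : ℝ) / c.νd)
    (ha1 : ((a1 : ℚ) : ℝ) ≤ Δ * f (K1 L)) (ha2 : Δ * f (K1 L) ≤ ((a2 : ℚ) : ℝ)) :
    lowGForm L Δ f ≤ (aD : ℝ) * etaEff L lam2 * Uunit L Δ f := by
  have hLpos : (0 : ℝ) < L := by exact_mod_cast (show 0 < L by omega)
  obtain ⟨hτlo, hτhi⟩ := tau_of_tauCheck L Δ lam2 f c a1 a2 τlo τhi piT hτ hc hL hΔ0 hΔ1 hf hν1 hν2 ha1 ha2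
  -- the box and the `ê₁` check
  unfold e1Check at he1
  split at he1
  · exact absurd he1 (by simp)
  · rename_i B hB
    have hmem := rowDBox_mem L Δ lam2 f c a1 a2 pi hB hc hL hΔ0 hΔ1 hf hν1 hν2 ha1 ha2
    have e1 := rexprLeOn_sound he1 _ hmem
    simp only [RExpr.eval, cst, vE1, xTrueD_e1] at e1
    push_cast at e1
    have he1' : (τhi : ℝ) - 2 * (eps1 L / (2 * Real.pi / L) ^ 2) ≤ -1 / 1000 := by linarith
    -- the representatives: `T(r_j) ≤ V²t·b_j` (zero-order rows and first-order rows)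
    have hrep : ∀ r ∈ repsZ ++ repsS, lowTerm L Δ f (B1.toTor L r.1.1) (B1.toTor L r.1.2)
        ≤ ((L : ℝ) ^ 2) ^ 2 * (2 * Real.pi / L) ^ 2 * ((r.2 : ℚ) : ℝ) := by
      intro r hr
      have hmemL : r.1 ∈ lowList := of_decide_eq_true (List.all_eq_true.mp hrepsMem r hr)
      have h1 := class_leC L Δ lam2 f czE hcz0 hwg hcz hL hΔ0 hΔ1 hf τlo τhi hτlo hτhi he1' hmemL
      have h3 : (termEC czE τlo τhi r.1.1 r.1.2).eval (xTrueD L Δ lam2 f) ≤ ((r.2 : ℚ) : ℝ) := by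
        rcases List.mem_append.mp hr with hz | hs
        · have hcls := List.all_eq_true.mp hrepsZ r hz
          unfold classCheckC at hcls
          rw [hB] at hcls
          exact rexprLeOn_sound hcls _ hmem
        · exact classCheckCS_sound (List.all_eq_true.mp hrepsS r hs) hB hmem
      exact h1.trans (mul_le_mul_of_nonneg_left h3 (by positivity))
    -- the rows: `T(k) = T(w·k) = T(r_j) ≤ V²t·b_j`
    refine lowG_of_rowBounds L Δ lam2 f (by omega) hΔ1 hf c aD τlo (orb.map fun row => (row.1, orbitBudget (repsZ ++ repsS) row))
      (by rw [List.map_map]; exact horb) ?_ (by rw [List.map_map]; exact hsum) haD hτlo0 hτlo hν1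
    intro p hp
    obtain ⟨row, hrow, rfl⟩ := List.mem_map.mp hp
    have hok1 := List.all_eq_true.mp hok row hrow
    unfold orbitRowOk at hok1
    unfold orbitBudget
    split at hok1
    · exact absurd hok1 (by simp)
    · rename_i r hr
      have hw : wordZ row.2.2 row.1 = r.1 := of_decide_eq_true hok1
      have hrmem : r ∈ repsZ ++ repsS := List.mem_of_getElem? hr
      have key := lowTerm_wordZ L (by omega) hf row.2.2 row.1
      rw [hw] at key
      show lowTerm L Δ f (B1.toTor L row.1.1) (B1.toTor L row.1.2) ≤ _
      rw [← key]
      exact hrep r hrmem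

/-- ★★★ **ORBIT FORM of the `c_W` certificate with FIRST-ORDER rows** (no extra hypothesis): `repsZ` by `classCheckW`, `repsS` by
`classCheckWS`, orbit table over `repsZ ++ repsS`, budget, `ê₁`/`τ` checks ⟹ `lowGForm ≤ a_D·η_eff·U` on the cell for every `L ≥ 128`. -/
theorem lowG_of_orbitChecksWS (c : L2.NamedCell) (a1 a2 aD τlo τhi : ℚ) (pi piT : ℕ × ℕ)
    (repsZ repsS : List (((ℤ × ℤ) × (ℤ × ℤ)) × ℚ)) (orb : List (((ℤ × ℤ) × (ℤ × ℤ)) × (ℕ × List ℕ)))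
    (hrepsMem : ((repsZ ++ repsS).all fun p => decide (p.1 ∈ lowList)) = true)
    (hrepsZ : (repsZ.all fun p => classCheckW c a1 a2 τlo τhi pi p.1 p.2) = true)
    (hrepsS : (repsS.all fun p => classCheckWS c a1 a2 τlo τhi pi p.1 p.2) = true)
    (horb : orb.map Prod.fst = lowList) (hok : (orb.all (orbitRowOk (repsZ ++ repsS))) = true)
    (hsum : (orb.map (orbitBudget (repsZ ++ repsS))).sum ≤ 3 * (98696 / 10000) * aD * ((c.n1 : ℚ) / c.νd) * τlo)
    (haD : 0 ≤ aD) (hτlo0 : 0 ≤ τlo) (he1 : e1Check c a1 a2 τhi pi = true) (hτ : tauCheck c a1 a2 τlo τhi piT = true)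
    (hc : c.check = true) (hL : 128 ≤ L)
    (hΔ0 : 0 ≤ Δ) (hΔ1 : Δ < 1) (hf : IsGroundTwoMagnon L Δ lam2 f)
    (hν1 : (c.n1 : ℝ) / c.νd ≤ lam2 / (2 * Real.pi / L) ^ 2) (hν2 : lam2 / (2 * Real.pi / L) ^ 2 ≤ (c.n2 : ℝ) / c.νd)
    (ha1 : ((a1 : ℚ) : ℝ) ≤ Δ * f (K1 L)) (ha2 : Δ * f (K1 L) ≤ ((a2 : ℚ) : ℝ)) :
    lowGForm L Δ f ≤ (aD : ℝ) * etaEff L lam2 * Uunit L Δ f := by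
  obtain ⟨hcz0, hwg⟩ := wg_hypW L Δ lam2 f hL hΔ0 hΔ1 hf
  exact lowG_of_orbitChecksCS L Δ lam2 f cWE c hcz0 hwg (eval_cWE L Δ lam2 f hL hΔ0 hf) a1 a2 aD τlo τhi pi piT repsZ repsS orb
    hrepsMem hrepsZ hrepsS horb hok hsum haD hτlo0 he1 hτ hc hL hΔ0 hΔ1 hf hν1 hν2 ha1 ha2

end sound

end RowD

end Summit.HubbardSuperconductivity.HubbardSuperconductivity.Theorems.AnisotropyChord.Transfer.Fibre3
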